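import Literature.MathematicalPhysics.QuantumLattice.FermionConditionalFreeEnergyCertificate
import Literature.MathematicalPhysics.QuantumLattice.HubbardNNNHoppingClusterEmbedding
import HarnessLib

/-!
# Conditional free-energy certificates with a shield of any codimension, and the certificate that comes for free from particle-number
# SECTOR FLOORS: `S(σ) − S(σ_{B₀}) − Re tr(σ·diag g(N)) ≤ log max_n Σ_j C(2|B∖B₀|, j) e^{−g(j+n)}`

Topic `Literature/MathematicalPhysics/QuantumLattice` (family `hubbard`; crew hubbard-fast S2 «multi-band, T > 0», seat hubbard-box-p1). The Markov /
conditional-entropy cap on a periodic pressure (`PeriodicMarkovEntropyBound`) reduces the `T > 0` problem to bounding the CLUSTER FUNCTIONAL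
`S(σ) − S(tr_{B→B₀} σ) − Re tr(σ H)` over density matrices `σ` on the Fock space of a window `B`, with `B₀ ⊂ B` a lexicographic initial segment (the
shield). `FermionConditionalFreeEnergyCertificate` proves the Poulin–Hastings certificate theorem for an abstract initial segment and instantiates it for
the codimension-one shield `B ∖ a`. This file supplies:

* §1 the shield of ANY codimension: `exists_lowerShield_split` (the split data) and **`fermion_condFreeEnergy_le_of_certificate_lowerSet`**:
  for `B₀ ⊆ B` closed downwards in the lexicographic order of `B`, `H ∈ 𝔄_B`, `L ∈ 𝔄_{B₀}` Hermitian and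
  `e^c·exp(L) − tr_{B→B₀} exp(−H + Γ L) ⪰ 0`:  `S(σ) − S(tr_{B→B₀} σ) − Re tr(σH) ≤ c` for every density matrix `σ ∈ 𝔄_B`.
* §2 **THE CERTIFICATE FROM SECTOR FLOORS** (`fermion_condFreeEnergy_cardDiagonal_le_log_of_split`, window form `…_lowerSet`): for the diagonal
  "energy" `D = diag(g(|u|))` (a function of the particle number of the occupation configuration `u`) the certificate with `L = 0` is EXPLICIT —
  `tr_{B→B₀} exp(−D)` is diagonal with entry `Σ_{j} C(2|A|, j) e^{−g(j + |l|)}` at a shield configuration `l` (`A = B ∖ B₀`, `2|A|` traced orbitals),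
  so `S(σ) − S(tr σ) − Re tr(σ D) ≤ log F` whenever `Σ_j C(2|A|,j) e^{−g(j+n)} ≤ F` for all `n ≤ 2|B₀|`. No matrix exponential is ever computed.
* §3 **SECTOR FLOORS ⇒ OPERATOR FLOOR** (`posSemidef_sub_cardDiagonal_of_forall_le_groundEnergy`): a Hermitian particle-number-conserving `H` with
  `q N ≤ E₀(H, N)` for all `N ≤ 2|Λ|` satisfies `H ⪰ diag(q(|u|))` — the sector-resolved form of `posSemidef_sub_smul_one_of_forall_le_groundEnergy`.
  With §2 (`g = β·q`): every table of certified sector ground-energy floors of a cluster (the `hubbard-box-p2` kernel certificates) is at once an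
  ENTROPY-RESOLVED conditional free-energy certificate, never worse than the flat `−β·min_N q N + |B∖B₀|·log 4`.

Everything is PROVED (0 sorry); no definition (the split data are produced inside `exists_lowerShield_split`), no named fact, no number.

## Tree / Mathlib search

REUSED: `fermion_condFreeEnergy_le_of_certificate_of_split`, `splitProdEquiv`, `traceLeft_submatrix_splitProdEquiv` (`FermionConditionalFreeEnergyCertificate`);
`toSpin`, `posSemidef_toSpin_iff`, `JordanWigner.config(Equiv)`, `card_config` (`HubbardJordanWigner`); `posSemidef_sub_smul_one_of_forall_le_groundEnergy`,
`card_orb` (`HubbardNNNHoppingClusterEmbedding`, `HubbardModelParticleHoleProofs`); `totalNumber_eq_diagonal_card`; `ThermodynamicLimit.groundEnergy_le_re_expect`,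
`groundEnergySet_nonempty`; `Literature.LinearAlgebra.Matrix.cfc_eq_conj_diagonal`; Mathlib `cfc_apply_zero`, `Finset.sum_powerset_apply_card`,
`Matrix.posSemidef_diagonal_iff`, `Matrix.submatrix_diagonal_equiv`. `lean search 'lowerSet.*certificate|cardDiagonal|sector.*condFreeEnergy'` (2026-08-28): nothing.

## References

* D. Poulin, M. B. Hastings, Phys. Rev. Lett. 106 (2011) 080403, eqs. (4)–(8). [cite: PoulinHastings2011, eqs. (4)–(8)]
* G. Lindblad, Commun. Math. Phys. 40 (1975) 147, Lemma 2. [cite: Lindblad1975, Lemma 2 p.149]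
* H. Araki, H. Moriya, Rev. Math. Phys. 15 (2003) 93, §4.1 (local CAR algebras, restriction to initial segments). [cite: ArakiMoriya2003, §4.1 Def. 4.5]
* E. H. Lieb, *The Hubbard model: some rigorous results and open problems*, arXiv:cond-mat/9311033, §2 (particle-number sectors). [cite: arXiv9311033, §2]
-/

noncomputable section

namespace Literature.MathematicalPhysics.QuantumLattice

open Matrix Finset HubbardWave0 Literature.Probability.LatticeModels
open scoped ComplexOrder
open Literature.Computability.QuantumComplexity (traceLeft traceLeft_apply)
open Literature.InformationTheory.Entropy (vonNeumannEntropy)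

/-! ### §1. Shields of any codimension: an initial segment `B₀ ⊆ B` of the window -/

section LowerShield

variable {d : ℕ} {B₀ B : Finset (Site d)}

/-- **The shield as an abstract initial segment.** For `B₀ ⊆ B` closed downwards in the lexicographic order of `B` there are an order embedding
`ι : B₀ ↪o B` with the isotony inclusion `PolySite.incl` as underlying map and lower-set range, and a compatible site splitting `B ≃ (B ∖ B₀) ⊔ B₀`
(the data of `fermion_condFreeEnergy_le_of_certificate_of_split`; compare `eraseInclO` / `windowSplitEquiv` for `B₀ = B ∖ a` and
`lowerInclO` / `cutSplitEquiv` of `FermionProductStateEntropy` for `B = Λl ∪ Λu`). [cite: ArakiMoriya2003, §4.1 Def. 4.1 (2)] -/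
theorem exists_lowerShield_split (h : B₀ ⊆ B) (hlow : ∀ x ∈ B₀, ∀ y ∈ B, toLex y ≤ toLex x → y ∈ B₀) :
    ∃ (ι : PolySite B₀ ↪o PolySite B) (ε : PolySite B ≃ PolySite (B \ B₀) ⊕ PolySite B₀),
      IsLowerSet (Set.range ι) ∧ ι.toEmbedding = PolySite.incl h ∧
        ι.toEmbedding = (Function.Embedding.inr : PolySite B₀ ↪ PolySite (B \ B₀) ⊕ PolySite B₀).trans ε.symm.toEmbedding := by
  let ι : PolySite B₀ ↪o PolySite B := OrderEmbedding.ofStrictMono (PolySite.incl h) fun _ _ hlt => hlt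
  let ε : PolySite B ≃ PolySite (B \ B₀) ⊕ PolySite B₀ :=
    { toFun := fun y =>
        if hy : ofLex y.1 ∈ B₀ then Sum.inr (PolySite.pt (ofLex y.1) hy)
        else Sum.inl (PolySite.pt (ofLex y.1) (Finset.mem_sdiff.2 ⟨PolySite.ofLex_mem y, hy⟩))
      invFun := Sum.elim (fun z => PolySite.incl Finset.sdiff_subset z) (fun z => PolySite.incl h z)
      left_inv := fun y => by
        by_cases hy : ofLex y.1 ∈ B₀
        · simp only [hy, dite_true, Sum.elim_inr]
          rfl
        · simp only [hy, dite_false, Sum.elim_inl]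
          rfl
      right_inv := fun z => by
        rcases z with z | z
        · have hz : ofLex (z : PolySite (B \ B₀)).1 ∉ B₀ := (Finset.mem_sdiff.1 (PolySite.ofLex_mem z)).2
          have h1 : ¬ ofLex (PolySite.incl Finset.sdiff_subset z).1 ∈ B₀ := hz
          simp only [Sum.elim_inl, h1, dite_false]
          rfl
        · have hz : ofLex (z : PolySite B₀).1 ∈ B₀ := PolySite.ofLex_mem z
          have h1 : ofLex (PolySite.incl h z).1 ∈ B₀ := hz
          simp only [Sum.elim_inr, h1, dite_true]
          rfl }
  refine ⟨ι, ε, ?_, DFunLike.ext _ _ fun _ => rfl, DFunLike.ext _ _ fun _ => rfl⟩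
  rintro y z hzy ⟨x, rfl⟩
  have hxB₀ : ofLex (x : PolySite B₀).1 ∈ B₀ := PolySite.ofLex_mem x
  have hzB : ofLex z.1 ∈ B := PolySite.ofLex_mem z
  have hle : z.1 ≤ (ι x).1 := hzy
  have hle' : toLex (ofLex z.1) ≤ toLex (ofLex (x : PolySite B₀).1) := by rw [toLex_ofLex, toLex_ofLex]; exact hle
  exact ⟨PolySite.pt (ofLex z.1) (hlow _ hxB₀ _ hzB hle'), Subtype.ext rfl⟩

/-- **Conditional free-energy certificate with a shield of any codimension.** Let `B₀ ⊆ B` be closed downwards in the lexicographic order of `B`,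
`H ∈ 𝔄_B` and `L ∈ 𝔄_{B₀}` Hermitian, `c` real, with `e^c · exp(L) − tr_{B→B₀} exp(−H + Γ L) ⪰ 0` in `𝔄_{B₀}`. Then every density matrix `σ ∈ 𝔄_B`
satisfies `S(σ) − S(tr_{B→B₀} σ) − Re tr(σ H) ≤ c`. [cite: PoulinHastings2011, eqs. (4)–(8)] [cite: Lindblad1975, Lemma 2 p.149] -/
theorem fermion_condFreeEnergy_le_of_certificate_lowerSet (h : B₀ ⊆ B) (hlow : ∀ x ∈ B₀, ∀ y ∈ B, toLex y ≤ toLex x → y ∈ B₀)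
    {σ H : FermionOp B} {LB : FermionOp B₀} {c : ℝ}
    (hσ : σ.PosSemidef) (htr : σ.trace = 1) (hH : H.IsHermitian) (hLB : LB.IsHermitian)
    (hcert : ((Real.exp c : ℂ) • cfc Real.exp LB -
      fermionPartialTrace (PolySite.incl h) (cfc Real.exp (-H + fermionEmbed (PolySite.incl h) LB))).PosSemidef) :
    vonNeumannEntropy σ - vonNeumannEntropy (fermionPartialTrace (PolySite.incl h) σ) - (σ * H).trace.re ≤ c := by
  obtain ⟨ι, ε, hι, hιh, hιε⟩ := exists_lowerShield_split h hlow
  rw [← hιh] at hcert ⊢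
  exact fermion_condFreeEnergy_le_of_certificate_of_split ι hι ε hιε hσ htr hH hLB hcert

end LowerShield

/-! ### §2. The explicit certificate for a particle-number-diagonal energy -/

section Split

open JordanWigner

variable {A Λ₁ Λ₂ : Type} [LinearOrder A] [Fintype A] [LinearOrder Λ₁] [Fintype Λ₁] [LinearOrder Λ₂] [Fintype Λ₂]

/-- **The particle number of a product configuration** is the sum of the particle numbers of its two factors:
`|Φ_ε(a, l)| = |config a| + |config l|`. [cite: EsslerEtAl2005, §12.3.4 eq. (12.196)] -/
theorem card_splitProdEquiv (ε : Λ₂ ≃ A ⊕ Λ₁) (a : TensorIndex A 4) (l : TensorIndex Λ₁ 4) :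
    (splitProdEquiv ε (a, l)).card = (config a).card + (config l).card := by
  have e : splitProdEquiv ε (a, l) = config fun x => Sum.elim a l (ε x) := rfl
  rw [e, card_config, card_config, card_config,
    Fintype.sum_equiv ε (fun x => siteCharge (Sum.elim a l (ε x))) (fun s => siteCharge (Sum.elim a l s)) (fun x => rfl),
    Fintype.sum_sum_type]
  rfl

/-- **Binomial generating identity**: summing a function of the particle number over the `4^{|A|}` local configurations of `A` collects
`C(2|A|, j)` configurations of each particle number `j`. [cite: NielsenChuang2010, §2.4.3 eq. (2.178)] -/
theorem sum_tensorIndex_card_config (f : ℕ → ℝ) :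
    ∑ a : TensorIndex A 4, f (config a).card = ∑ j ∈ Finset.range (2 * Fintype.card A + 1), ((2 * Fintype.card A).choose j : ℝ) * f j := by
  have h1 : ∑ a : TensorIndex A 4, f (config a).card = ∑ s : Finset (Orb A), f s.card := by
    rw [← Equiv.sum_comp (JordanWigner.configEquiv (Λ := A)) (fun s : Finset (Orb A) => f s.card)]
    rfl
  have h2 : ∑ s : Finset (Orb A), f s.card = ∑ s ∈ (Finset.univ : Finset (Orb A)).powerset, f s.card := by
    rw [Finset.powerset_univ]
  rw [h1, h2, Finset.sum_powerset_apply_card, Finset.card_univ, card_orb]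
  simp only [nsmul_eq_mul]

/-- The partial trace over the first tensor factor of a diagonal matrix is diagonal. [cite: NielsenChuang2010, §2.4.3 eq. (2.178)] -/
theorem traceLeft_diagonal' {m n : Type} [Fintype m] [Fintype n] [DecidableEq m] [DecidableEq n] (dd : m × n → ℂ) :
    traceLeft (diagonal dd) = diagonal fun b => ∑ a, dd (a, b) := by
  ext b b'
  simp only [traceLeft_apply, diagonal_apply, Prod.mk.injEq, true_and]
  by_cases hb : b = b'
  · subst hb
    simp
  · simp [hb]

/-- `cfc` of a real diagonal matrix is the diagonal matrix of values. [folklore] -/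
private theorem cfc_diagonal_ofReal' {n : Type*} [Fintype n] [DecidableEq n] (μ : n → ℝ) (f : ℝ → ℝ) :
    cfc f (diagonal fun k => ((μ k : ℝ) : ℂ)) = diagonal fun k => ((f (μ k) : ℝ) : ℂ) := by
  have h := Literature.LinearAlgebra.Matrix.cfc_eq_conj_diagonal (𝕜 := ℂ) (A := diagonal fun k => ((μ k : ℝ) : ℂ))
    (V := 1) (Submonoid.one_mem _) (μ := μ) (by simp) f
  simpa using h

/-- **THE CONDITIONAL FREE-ENERGY CERTIFICATE FROM A PARTICLE-NUMBER-DIAGONAL ENERGY (abstract initial segment).** Let `ι : Λ₁ ↪o Λ₂` be an initial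
segment split as `ε : Λ₂ ≃ A ⊕ Λ₁`, `g : ℕ → ℝ`, and `F > 0` with `Σ_{j ≤ 2|A|} C(2|A|, j) e^{−g(j+n)} ≤ F` for every `n ≤ 2|Λ₁|`. Then for every density
matrix `σ` on the Fock space over `Λ₂`: `S(σ) − S(tr_ι σ) − Re tr(σ · diag g(|u|)) ≤ log F`. (The Poulin–Hastings certificate with `L = 0`:
`tr_ι exp(−diag g(|u|))` is the diagonal matrix `l ↦ Σ_j C(2|A|,j) e^{−g(j+|l|)}`.) [cite: PoulinHastings2011, eqs. (4)–(8)] [cite: arXiv9311033, §2] -/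
theorem fermion_condFreeEnergy_cardDiagonal_le_log_of_split (ι : Λ₁ ↪o Λ₂) (hι : IsLowerSet (Set.range ι)) (ε : Λ₂ ≃ A ⊕ Λ₁)
    (hιε : ι.toEmbedding = (Function.Embedding.inr : Λ₁ ↪ A ⊕ Λ₁).trans ε.symm.toEmbedding) (g : ℕ → ℝ) {F : ℝ} (hF0 : 0 < F)
    (hF : ∀ n ≤ 2 * Fintype.card Λ₁,
      ∑ j ∈ Finset.range (2 * Fintype.card A + 1), ((2 * Fintype.card A).choose j : ℝ) * Real.exp (-g (j + n)) ≤ F)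
    {σ : Matrix (Finset (Orb Λ₂)) (Finset (Orb Λ₂)) ℂ} (hσ : σ.PosSemidef) (htr : σ.trace = 1) :
    vonNeumannEntropy σ - vonNeumannEntropy (fermionPartialTrace ι.toEmbedding σ) -
      (σ * diagonal fun u : Finset (Orb Λ₂) => ((g u.card : ℝ) : ℂ)).trace.re ≤ Real.log F := by
  set D : Matrix (Finset (Orb Λ₂)) (Finset (Orb Λ₂)) ℂ := diagonal fun u : Finset (Orb Λ₂) => ((g u.card : ℝ) : ℂ) with hD_def
  have hD : D.IsHermitian := Matrix.isHermitian_diagonal_of_self_adjoint _ (funext fun u => by simp)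
  have h0 : (0 : Matrix (Finset (Orb Λ₁)) (Finset (Orb Λ₁)) ℂ).IsHermitian := Matrix.isHermitian_zero
  refine fermion_condFreeEnergy_le_of_certificate_of_split ι hι ε hιε hσ htr hD h0 (c := Real.log F) ?_
  -- the explicit certificate
  have hexpD : cfc Real.exp (-D + fermionEmbed ι.toEmbedding 0) = diagonal fun u : Finset (Orb Λ₂) => ((Real.exp (-g u.card) : ℝ) : ℂ) := by
    rw [map_zero, add_zero]
    have e : -D = diagonal fun u : Finset (Orb Λ₂) => ((-g u.card : ℝ) : ℂ) := by
      rw [hD_def, Matrix.diagonal_neg]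
      congr 1
      funext u
      push_cast
      ring
    rw [e, cfc_diagonal_ofReal']
  have hexp0 : cfc Real.exp (0 : Matrix (Finset (Orb Λ₁)) (Finset (Orb Λ₁)) ℂ) = 1 := by
    rw [cfc_apply_zero, Real.exp_zero, map_one]
  rw [hexp0, hexpD, Real.exp_log hF0, ← posSemidef_toSpin_iff, map_sub, map_smul, map_one,
    ← traceLeft_submatrix_splitProdEquiv ι hι ε hιε, Matrix.submatrix_diagonal_equiv, traceLeft_diagonal']
  have e : (F : ℂ) • (1 : Matrix (TensorIndex Λ₁ 4) (TensorIndex Λ₁ 4) ℂ) -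
      diagonal (fun l => ∑ a, ((fun u : Finset (Orb Λ₂) => ((Real.exp (-g u.card) : ℝ) : ℂ)) ∘ splitProdEquiv ε) (a, l)) =
      diagonal fun l => (F : ℂ) - ∑ a : TensorIndex A 4, ((Real.exp (-g (splitProdEquiv ε (a, l)).card) : ℝ) : ℂ) := by
    ext i j
    simp only [Matrix.sub_apply, Matrix.smul_apply, Matrix.one_apply, diagonal_apply, Function.comp_apply, smul_eq_mul]
    split_ifs <;> simp
  rw [e, Matrix.posSemidef_diagonal_iff]
  intro l
  have hn : (config l).card ≤ 2 * Fintype.card Λ₁ := by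
    rw [← card_orb]
    exact Finset.card_le_univ _
  have hsum : ∑ a : TensorIndex A 4, Real.exp (-g (splitProdEquiv ε (a, l)).card) ≤ F := by
    calc ∑ a : TensorIndex A 4, Real.exp (-g (splitProdEquiv ε (a, l)).card)
        = ∑ a : TensorIndex A 4, Real.exp (-g ((config a).card + (config l).card)) := by
          simp_rw [card_splitProdEquiv]
      _ = ∑ j ∈ Finset.range (2 * Fintype.card A + 1), ((2 * Fintype.card A).choose j : ℝ) * Real.exp (-g (j + (config l).card)) :=
          sum_tensorIndex_card_config (fun j => Real.exp (-g (j + (config l).card)))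
      _ ≤ F := hF _ hn
  have hcast : (F : ℂ) - ∑ a : TensorIndex A 4, ((Real.exp (-g (splitProdEquiv ε (a, l)).card) : ℝ) : ℂ) =
      ((F - ∑ a : TensorIndex A 4, Real.exp (-g (splitProdEquiv ε (a, l)).card) : ℝ) : ℂ) := by
    push_cast
    rfl
  rw [hcast, Complex.zero_le_real, sub_nonneg]
  exact hsum

end Split

/-! ### §2'. The window form: a shield `B₀ ⊆ B` of `ℤ^d` -/

section Window

variable {d : ℕ} {B₀ B : Finset (Site d)}

/-- **THE CONDITIONAL FREE-ENERGY CERTIFICATE FROM SECTOR DATA, window form.** For a shield `B₀ ⊆ B` closed downwards in the lexicographic order,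
`g : ℕ → ℝ` and `F > 0` with `Σ_{j ≤ 2|B∖B₀|} C(2|B∖B₀|, j) e^{−g(j+n)} ≤ F` for all `n ≤ 2|B₀|`, every density matrix `σ ∈ 𝔄_B` satisfies
`S(σ) − S(tr_{B→B₀} σ) − Re tr(σ · diag g(|u|)) ≤ log F`. [cite: PoulinHastings2011, eqs. (4)–(8)] [cite: arXiv9311033, §2] -/
theorem fermion_condFreeEnergy_cardDiagonal_le_log_lowerSet (h : B₀ ⊆ B) (hlow : ∀ x ∈ B₀, ∀ y ∈ B, toLex y ≤ toLex x → y ∈ B₀)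
    (g : ℕ → ℝ) {F : ℝ} (hF0 : 0 < F)
    (hF : ∀ n ≤ 2 * B₀.card,
      ∑ j ∈ Finset.range (2 * (B \ B₀).card + 1), ((2 * (B \ B₀).card).choose j : ℝ) * Real.exp (-g (j + n)) ≤ F)
    {σ : FermionOp B} (hσ : σ.PosSemidef) (htr : σ.trace = 1) :
    vonNeumannEntropy σ - vonNeumannEntropy (fermionPartialTrace (PolySite.incl h) σ) -
      (σ * diagonal fun u : Finset (Orb (PolySite B)) => ((g u.card : ℝ) : ℂ)).trace.re ≤ Real.log F := by
  have hA : Fintype.card (PolySite (B \ B₀)) = (B \ B₀).card := by rw [Fintype.card_coe, lexSites, Finset.card_map]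
  have hB₀ : Fintype.card (PolySite B₀) = B₀.card := by rw [Fintype.card_coe, lexSites, Finset.card_map]
  obtain ⟨ι, ε, hι, hιh, hιε⟩ := exists_lowerShield_split h hlow
  rw [← hιh]
  refine fermion_condFreeEnergy_cardDiagonal_le_log_of_split ι hι ε hιε g hF0 (fun n hn => ?_) hσ htr
  rw [hA]
  exact hF n (by rwa [hB₀] at hn)

end Window

/-! ### §3. Sector floors give the operator floor `H ⪰ diag q(|u|)` -/

section SectorFloors

variable {Λ : Type*} [LinearOrder Λ] [Fintype Λ]

/-- Rayleigh introduction rule for a sector floor (`N ≤ 2|Λ|`). [cite: arXiv9311033, §2] -/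
private theorem le_groundEnergy_of_forall_re_expect'' (H : Matrix (Finset (Orb Λ)) (Finset (Orb Λ)) ℂ) {N : ℕ}
    (hN : N ≤ Fintype.card (Orb Λ)) {c : ℝ} (h : ∀ ψ : Fock (Orb Λ), IsNParticle N ψ → star ψ ⬝ᵥ ψ = 1 → c ≤ (expect H ψ).re) :
    c ≤ groundEnergy H N := by
  unfold groundEnergy
  refine le_csInf (ThermodynamicLimit.groundEnergySet_nonempty H hN) ?_
  rintro E ⟨ψ, hψN, hψ1, rfl⟩
  exact h ψ hψN hψ1

/-- **SECTOR FLOORS ⇒ `H ⪰ diag q(|u|)`.** A Hermitian, particle-number conserving `H` on the Fock space over `Λ` with `q N ≤ E₀(H, N)` for every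
`N ≤ 2|Λ|` dominates the diagonal operator `u ↦ q(|u|)`: `H − diag q(|u|) ⪰ 0` (on each sector `H ≥ E₀(H,N) ≥ q N`, and `H` does not mix sectors).
[cite: arXiv9311033, §2] -/
theorem posSemidef_sub_cardDiagonal_of_forall_le_groundEnergy {H : Matrix (Finset (Orb Λ)) (Finset (Orb Λ)) ℂ} (hH : H.IsHermitian)
    (hHN : Commute H totalNumber) (q : ℕ → ℝ) (hq : ∀ N ≤ 2 * Fintype.card Λ, q N ≤ groundEnergy H N) :
    (H - diagonal fun s : Finset (Orb Λ) => ((q s.card : ℝ) : ℂ)).PosSemidef := by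
  set D : Matrix (Finset (Orb Λ)) (Finset (Orb Λ)) ℂ := diagonal fun s : Finset (Orb Λ) => ((q s.card : ℝ) : ℂ) with hD_def
  have hD : D.IsHermitian := Matrix.isHermitian_diagonal_of_self_adjoint _ (funext fun u => by simp)
  have hHD : (H - D).IsHermitian := hH.sub hD
  have hDN : Commute D totalNumber := by
    rw [hD_def, totalNumber_eq_diagonal_card, Commute, SemiconjBy, diagonal_mul_diagonal, diagonal_mul_diagonal]
    congr 1
    funext s
    ring
  have hcomm : Commute (H - D) totalNumber := hHN.sub_left hDN
  have hsec : ∀ N ≤ 2 * Fintype.card Λ, (0 : ℝ) ≤ groundEnergy (H - D) N := by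
    intro N hN
    refine le_groundEnergy_of_forall_re_expect'' (H - D) (by rw [card_orb]; exact hN) fun ψ hψN hψ1 => ?_
    have hDψ : D *ᵥ ψ = ((q N : ℝ) : ℂ) • ψ := by
      funext s
      rw [hD_def, mulVec_diagonal, Pi.smul_apply, smul_eq_mul]
      by_cases hs : s.card = N
      · rw [hs]
      · rw [hψN s hs, mul_zero, mul_zero]
    have hE := ThermodynamicLimit.groundEnergy_le_re_expect H hψN hψ1
    have e : expect (H - D) ψ = expect H ψ - ((q N : ℝ) : ℂ) := by
      unfold expect
      rw [sub_mulVec, dotProduct_sub, hDψ, dotProduct_smul, hψ1, smul_eq_mul, mul_one]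
    rw [e, Complex.sub_re, Complex.ofReal_re]
    linarith [hq N hN]
  have h := posSemidef_sub_smul_one_of_forall_le_groundEnergy hHD hcomm hsec
  rwa [Complex.ofReal_zero, zero_smul, sub_zero] at h

end SectorFloors

end Literature.MathematicalPhysics.QuantumLattice

end
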